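import Summits.QuantumFields.YangMills.Theorems.ColdStartUniversalityLatticeLangevinLatitudeAlgebra
import Literature.MathematicalPhysics.QuantumFieldTheory.ShenZhuZhuErgodicity
import Mathlib.Analysis.SpecialFunctions.Trigonometric.Inverse
import Mathlib.Analysis.SpecialFunctions.Trigonometric.Bounds
import HarnessLib

/-!
# Shen–Zhu–Zhu's Riemannian distance `ρ` on `SU(2)` IN CLOSED FORM: `ρ(g,h) = √2 · arccos(Re tr(h g⁻¹)/2)`, the infimum in
# `LatticeRep.riemannDist` is ATTAINED by an explicit logarithm, and `ρ` is comparable to the chordal (Frobenius) distance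

Seat `ym-line-csu-p1` (g41), route `ColdStartUniversality` of `Summits/QuantumFields/YangMills`, helper file G40 (`--supports stmt-QuantumFields-24809`).
The Literature (`ShenZhuZhuErgodicity`) renders the metric of Shen–Zhu–Zhu's Theorem 4.2 (4.5) / Lemma 5.1 — the Riemannian distance of the
bi-invariant Hilbert–Schmidt metric — as `LatticeRep.riemannDist r g h = inf {|X| : X ∈ 𝔤, e^X ρ(g) = ρ(h)}` (`|X|² = Re tr(XXᴴ)`, junk `0` if no
`X` exists) and the cost of (4.5) as `torusRiemannDistSq r U U' = Σ_e ρ(U_e,U'_e)²`; the tree had only `ρ ≥ 0` and `ρ(g,g) = 0`.  For the route's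
group `SU(2)` (`r = fundamentalLatticeRep 2`, `𝔤 = 𝔰𝔲(2)`) everything is explicit (unit quaternions):

* §1 `mul_self_eq_neg_smul_one_of_mem_lieAlg_two` — every `X ∈ 𝔰𝔲(2)` satisfies `X² = −θ²·1`, `θ² = |X|²/2`;
* §2 `exp_eq_cos_smul_one_add_smul_of_mul_self` — `e^A = cos θ · 1 + (sin θ/θ) · A` whenever `A² = −θ²·1`, `θ ≠ 0` (power series); hence
  `re_trace_exp_of_mem_lieAlg_two` — `Re tr e^X = 2 cos θ_X`;
* §3 ★★★ `riemannDist_two_eq` — **`ρ(g,h) = √2 · arccos(Re tr(h gᴴ)/2)`** for all `g, h ∈ SU(2)`; the infimum is attained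
  (`exists_mem_lieAlg_exp_mul_eq`: an explicit `X ∈ 𝔰𝔲(2)` with `e^X g = h` and `|X| = ρ(g,h)` — surjectivity of `exp : 𝔰𝔲(2) → SU(2)` with the
  minimal logarithm), and every logarithm is at least that long (`sqrt_two_mul_arccos_le_of_exp_mul_eq`);
The consequences (symmetry, diameter `√2·π`, `ρ = 0 ↔ g = h`, and the chord–arc comparison `‖h − g‖_F ≤ ρ(g,h) ≤ (π/2)‖h − g‖_F` with its
`torusRiemannDistSq` version — the conversion between the seat's Frobenius-Lipschitz currency and the Riemannian currency of the named facts
`shenZhuZhu_finiteVolumeErgodicity` / `shenZhuZhu_weightedContraction`, whose `W₂` contraction (4.5) is NOT proved here) are in the sequel file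
`…ShenZhuZhuRiemannDistComparisonSU2`.

THEOREMS ONLY, no definition, no sorry.  HONEST FRAMING: metric geometry of one link; nothing about the dynamics, nothing `K`-uniform along the
route's scaling (`UniformColdStartMixing`, 24809, ASIDE, not restated); no crux, rung or summit statement is proved; the Yang–Mills mass gap is NOT
proved.

References: H. Shen, R. Zhu, X. Zhu, CMP 400 (2023) 805–851 = arXiv:2204.12737, §2 (2.3), §4.1 (the distance `ρ`, `ρ_L`), Thm 4.2 (4.5)
[ShenZhuZhu2022]; S. Gallot, D. Hulin, J. Lafontaine, *Riemannian Geometry* (2004), 2.90, 2.108 [GallotHulinLafontaine2004].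
-/

set_option autoImplicit false

noncomputable section

namespace Summit.QuantumFields.YangMills.Theorems.ColdStartUniversality

open Matrix Complex Finset
open scoped ComplexConjugate BigOperators Real
open Literature.MathematicalPhysics.QuantumFieldTheory
open Literature.MathematicalPhysics.QuantumLattice (fundamentalRep fundamentalLatticeRep fundamentalRep_apply fundamentalLatticeRep_N)

/-! ## §1. `𝔰𝔲(2)`: every element squares to a non-positive scalar -/

/-- A traceless `2 × 2` matrix squares to a scalar: `M² = −det M · 1` (Cayley–Hamilton). [folklore] -/
theorem mul_self_eq_neg_det_smul_one_of_trace_eq_zero (M : Matrix (Fin 2) (Fin 2) ℂ) (hM : M.trace = 0) :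
    M * M = (-M.det) • (1 : Matrix (Fin 2) (Fin 2) ℂ) := by
  have h11 : M 1 1 = -M 0 0 := by
    rw [Matrix.trace_fin_two] at hM
    linear_combination hM
  ext i j
  rw [Matrix.det_fin_two]
  fin_cases i <;> fin_cases j <;>
    simp [Matrix.mul_apply, Fin.sum_univ_two, h11] <;> ring

/-- For `X ∈ 𝔰𝔲(2)` (the embedded Lie algebra of `fundamentalLatticeRep 2`: skew-Hermitian and traceless):
`|X|² = Re tr(XXᴴ) = 2·((Im X₀₀)² + |X₀₁|²)`. [folklore] -/
theorem hsForm_self_of_mem_lieAlg_two {X : Matrix (Fin 2) (Fin 2) ℂ}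
    (hX : X ∈ (fundamentalLatticeRep 2).lieAlg) :
    hsForm 2 X X = 2 * ((X 0 0).im ^ 2 + ((X 0 1).re ^ 2 + (X 0 1).im ^ 2)) := by
  have hstar : star X = -X := (fundamentalLatticeRep 2).star_eq_neg_of_mem_lieAlg hX
  have htr : X.trace = 0 := trace_eq_zero_of_mem_lieAlg_two hX
  have h00 : conj (X 0 0) = -X 0 0 := by
    have := congrFun (congrFun hstar 0) 0
    simpa [Matrix.star_apply] using this
  have h10 : X 1 0 = -conj (X 0 1) := by
    have := congrFun (congrFun hstar 1) 0
    have h' : conj (X 0 1) = -X 1 0 := by simpa [Matrix.star_apply] using this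
    rw [h', neg_neg]
  have h11 : X 1 1 = -X 0 0 := by
    rw [Matrix.trace_fin_two] at htr
    linear_combination htr
  have hre : (X 0 0).re = 0 := by
    have := congrArg Complex.re h00
    simp only [Complex.conj_re, Complex.neg_re] at this
    linarith
  rw [hsForm_self]
  simp only [Fin.sum_univ_two, h10, h11, norm_neg, Complex.norm_conj]
  rw [Complex.sq_norm, Complex.sq_norm, Complex.normSq_apply, Complex.normSq_apply, hre]
  ring

/-- ★ **Every `X ∈ 𝔰𝔲(2)` squares to `−θ²·1` with `θ² = |X|²/2`** (`X = [[ia, w], [−w̄, −ia]]`, `X² = −(a² + |w|²)·1`).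
[folklore] -/
theorem mul_self_eq_neg_smul_one_of_mem_lieAlg_two {X : Matrix (Fin 2) (Fin 2) ℂ}
    (hX : X ∈ (fundamentalLatticeRep 2).lieAlg) :
    X * X = -(((hsForm 2 X X / 2 : ℝ) : ℂ)) • (1 : Matrix (Fin 2) (Fin 2) ℂ) := by
  have hstar : star X = -X := (fundamentalLatticeRep 2).star_eq_neg_of_mem_lieAlg hX
  have htr : X.trace = 0 := trace_eq_zero_of_mem_lieAlg_two hX
  have h00 : conj (X 0 0) = -X 0 0 := by
    have := congrFun (congrFun hstar 0) 0
    simpa [Matrix.star_apply] using this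
  have h10 : X 1 0 = -conj (X 0 1) := by
    have := congrFun (congrFun hstar 1) 0
    have h' : conj (X 0 1) = -X 1 0 := by simpa [Matrix.star_apply] using this
    rw [h', neg_neg]
  have h11 : X 1 1 = -X 0 0 := by
    rw [Matrix.trace_fin_two] at htr
    linear_combination htr
  have hre : (X 0 0).re = 0 := by
    have := congrArg Complex.re h00
    simp only [Complex.conj_re, Complex.neg_re] at this
    linarith
  rw [mul_self_eq_neg_det_smul_one_of_trace_eq_zero X htr, hsForm_self_of_mem_lieAlg_two hX]
  congr 1
  rw [Matrix.det_fin_two, h10, h11]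
  apply Complex.ext
  · simp only [Complex.neg_re, Complex.sub_re, Complex.mul_re, Complex.neg_im, Complex.conj_re, Complex.conj_im,
      Complex.ofReal_re, hre]
    ring
  · simp only [Complex.neg_im, Complex.sub_im, Complex.mul_im, Complex.neg_re, Complex.neg_im, Complex.conj_re,
      Complex.conj_im, Complex.ofReal_im, hre]
    ring

/-! ## §2. The exponential of a matrix with `A² = −θ²·1` -/

/-- ★ **`e^A = cos θ · 1 + (sin θ/θ) · A` for a complex square matrix with `A² = −θ²·1`, `θ ≠ 0`** (even powers `A^{2k} = (−θ²)^k·1` sum to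
`cos θ · 1`, odd powers to `(sin θ/θ)·A`; Rodrigues' formula for `𝔰𝔲(2) ≅ 𝔰𝔬(3)`). [folklore] -/
theorem exp_eq_cos_smul_one_add_smul_of_mul_self {m : Type*} [Fintype m] [DecidableEq m] (A : Matrix m m ℂ) {θ : ℝ}
    (hA : A * A = -(((θ : ℂ)) ^ 2) • (1 : Matrix m m ℂ)) (hθ : θ ≠ 0) :
    NormedSpace.exp A = (Real.cos θ : ℂ) • (1 : Matrix m m ℂ) + ((Real.sin θ / θ : ℝ) : ℂ) • A := by
  set c : ℂ := -((θ : ℂ) ^ 2) with hc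
  rw [congrFun (NormedSpace.exp_eq_tsum ℂ) _]
  refine HasSum.tsum_eq ?_
  have hAeven : ∀ k : ℕ, A ^ (2 * k) = (c ^ k) • (1 : Matrix m m ℂ) := fun k => by
    rw [pow_mul, sq, hA, smul_pow, one_pow]
  have hAodd : ∀ k : ℕ, A ^ (2 * k + 1) = (c ^ k) • A := fun k => by
    rw [pow_succ, hAeven, smul_mul_assoc, one_mul]
  have key : ∀ k : ℕ, ((Nat.factorial k : ℂ)⁻¹) • A ^ k = ((Nat.factorial k : ℂ)⁻¹) • A ^ k := fun _ => rfl
  have hθc : (θ : ℂ) ≠ 0 := Complex.ofReal_ne_zero.2 hθ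
  have he : HasSum (fun k : ℕ => ((Nat.factorial (2 * k) : ℂ)⁻¹) • A ^ (2 * k)) ((Complex.cos (θ : ℂ)) • (1 : Matrix m m ℂ)) := by
    simp_rw [hAeven, smul_smul]
    refine HasSum.smul_const ?_ _
    have hfun : (fun k : ℕ => (Nat.factorial (2 * k) : ℂ)⁻¹ * c ^ k) = fun k : ℕ => (-1) ^ k * (θ : ℂ) ^ (2 * k) / (Nat.factorial (2 * k) : ℂ) := by
      funext k
      rw [hc, neg_pow, ← pow_mul]
      ring
    rw [hfun]
    exact Complex.hasSum_cos _
  have ho : HasSum (fun k : ℕ => ((Nat.factorial (2 * k + 1) : ℂ)⁻¹) • A ^ (2 * k + 1)) (((θ : ℂ)⁻¹ * Complex.sin (θ : ℂ)) • A) := by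
    simp_rw [hAodd, smul_smul]
    refine HasSum.smul_const ?_ _
    have hfun : (fun k : ℕ => (Nat.factorial (2 * k + 1) : ℂ)⁻¹ * c ^ k) =
        fun k : ℕ => (θ : ℂ)⁻¹ * ((-1) ^ k * (θ : ℂ) ^ (2 * k + 1) / (Nat.factorial (2 * k + 1) : ℂ)) := by
      funext k
      rw [hc, neg_pow, ← pow_mul, pow_succ]
      field_simp
    rw [hfun]
    exact (Complex.hasSum_sin _).mul_left _
  have hsum := HasSum.even_add_odd (f := fun k : ℕ => ((Nat.factorial k : ℂ)⁻¹) • A ^ k) he ho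
  have hval : (Real.cos θ : ℂ) • (1 : Matrix m m ℂ) + ((Real.sin θ / θ : ℝ) : ℂ) • A =
      Complex.cos (θ : ℂ) • (1 : Matrix m m ℂ) + ((θ : ℂ)⁻¹ * Complex.sin (θ : ℂ)) • A := by
    rw [Complex.ofReal_cos, Complex.ofReal_div, Complex.ofReal_sin, div_eq_inv_mul]
  rw [hval]
  exact hsum

/-- For `X ∈ 𝔰𝔲(2)` with `θ = √(|X|²/2) ≠ 0`: `e^X = cos θ · 1 + (sin θ/θ) · X`. [folklore] -/
theorem exp_eq_of_mem_lieAlg_two {X : Matrix (Fin 2) (Fin 2) ℂ}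
    (hX : X ∈ (fundamentalLatticeRep 2).lieAlg) (hθ : Real.sqrt (hsForm 2 X X / 2) ≠ 0) :
    NormedSpace.exp X = (Real.cos (Real.sqrt (hsForm 2 X X / 2)) : ℂ) • (1 : Matrix (Fin 2) (Fin 2) ℂ) +
      ((Real.sin (Real.sqrt (hsForm 2 X X / 2)) / Real.sqrt (hsForm 2 X X / 2) : ℝ) : ℂ) • X := by
  refine exp_eq_cos_smul_one_add_smul_of_mul_self X ?_ hθ
  rw [mul_self_eq_neg_smul_one_of_mem_lieAlg_two hX]
  congr 2
  rw [← Complex.ofReal_pow, Real.sq_sqrt (by have := hsForm_self_nonneg (N := 2) X; positivity)]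

/-- ★ **`Re tr e^X = 2 cos θ_X`** for `X ∈ 𝔰𝔲(2)`, `θ_X = √(|X|²/2)` (also when `θ_X = 0`, i.e. `X = 0`). [folklore] -/
theorem re_trace_exp_of_mem_lieAlg_two {X : Matrix (Fin 2) (Fin 2) ℂ}
    (hX : X ∈ (fundamentalLatticeRep 2).lieAlg) :
    (NormedSpace.exp X).trace.re = 2 * Real.cos (Real.sqrt (hsForm 2 X X / 2)) := by
  by_cases hθ : Real.sqrt (hsForm 2 X X / 2) = 0
  · have h0 : hsForm 2 X X = 0 := by
      rw [Real.sqrt_eq_zero (by have := hsForm_self_nonneg (N := 2) X; positivity)] at hθ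
      linarith
    have hX0 : X = 0 := (hsForm_self_eq_zero).1 h0
    rw [hθ, hX0, NormedSpace.exp_zero, Real.cos_zero, Matrix.trace_one, Fintype.card_fin]
    norm_num
  · have htr : X.trace = 0 := trace_eq_zero_of_mem_lieAlg_two hX
    rw [exp_eq_of_mem_lieAlg_two hX hθ, Matrix.trace_add, Matrix.trace_smul, Matrix.trace_smul, htr, Matrix.trace_one, Fintype.card_fin]
    simp only [add_zero, smul_eq_mul, Nat.cast_ofNat, Complex.mul_re, Complex.ofReal_re, Complex.ofReal_im, Complex.re_ofNat,
      Complex.im_ofNat, mul_zero, sub_zero]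
    ring

/-- `e^X = cos θ · 1 + (sin θ/θ) · X` for `X ∈ 𝔰𝔲(2)` with `√(|X|²/2) = θ ≠ 0` (named-angle form). [folklore] -/
theorem exp_eq_of_mem_lieAlg_two' {X : Matrix (Fin 2) (Fin 2) ℂ} (hX : X ∈ (fundamentalLatticeRep 2).lieAlg) {θ : ℝ}
    (hθ : Real.sqrt (hsForm 2 X X / 2) = θ) (hθ0 : θ ≠ 0) :
    NormedSpace.exp X = (Real.cos θ : ℂ) • (1 : Matrix (Fin 2) (Fin 2) ℂ) + ((Real.sin θ / θ : ℝ) : ℂ) • X := by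
  subst hθ
  exact exp_eq_of_mem_lieAlg_two hX hθ0

/-! ## §3. The Riemannian distance on `SU(2)` in closed form -/

section Distance

/-- `↑(h g⁻¹) = ↑h · (↑g)ᴴ` in `M₂(ℂ)` (the inverse in `SU(2)` is the conjugate transpose). [folklore] -/
theorem coe_mul_inv_specialUnitaryGroup_two (g h : Matrix.specialUnitaryGroup (Fin 2) ℂ) :
    ((h * g⁻¹ : Matrix.specialUnitaryGroup (Fin 2) ℂ) : Matrix (Fin 2) (Fin 2) ℂ) =
      (h : Matrix (Fin 2) (Fin 2) ℂ) * star (g : Matrix (Fin 2) (Fin 2) ℂ) := rfl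

/-- `e^X · g = h ↔ e^X = h · gᴴ` for `g, h ∈ SU(2)`. [folklore] -/
theorem exp_mul_eq_iff_two (g h : Matrix.specialUnitaryGroup (Fin 2) ℂ) (X : Matrix (Fin 2) (Fin 2) ℂ) :
    NormedSpace.exp X * (g : Matrix (Fin 2) (Fin 2) ℂ) = (h : Matrix (Fin 2) (Fin 2) ℂ) ↔
      NormedSpace.exp X = (h : Matrix (Fin 2) (Fin 2) ℂ) * star (g : Matrix (Fin 2) (Fin 2) ℂ) := by
  have h1 : (g : Matrix (Fin 2) (Fin 2) ℂ) * star (g : Matrix (Fin 2) (Fin 2) ℂ) = 1 := g.prop.1.2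
  have h2 : star (g : Matrix (Fin 2) (Fin 2) ℂ) * (g : Matrix (Fin 2) (Fin 2) ℂ) = 1 := g.prop.1.1
  constructor
  · intro hX
    rw [← hX, Matrix.mul_assoc, h1, Matrix.mul_one]
  · intro hX
    rw [hX, Matrix.mul_assoc, h2, Matrix.mul_one]

/-- The LATITUDE `c = Re tr(k)/2` of `k ∈ SU(2)` lies in `[−1, 1]` (`‖𝐩 k‖² = 2(1 − c²) ≥ 0`). [folklore] -/
theorem neg_one_le_half_re_trace_two (k : Matrix.specialUnitaryGroup (Fin 2) ℂ) :
    -1 ≤ (k : Matrix (Fin 2) (Fin 2) ℂ).trace.re / 2 ∧ (k : Matrix (Fin 2) (Fin 2) ℂ).trace.re / 2 ≤ 1 := by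
  have h := hsForm_lieProj_rho_two k
  have h0 := hsForm_self_nonneg (N := 2) ((fundamentalLatticeRep 2).lieProj ((fundamentalLatticeRep 2).ρ k))
  have hc : 0 ≤ 1 - (((fundamentalLatticeRep 2).ρ k).trace.re / 2) ^ 2 := by
    have : hsForm (fundamentalLatticeRep 2).N ((fundamentalLatticeRep 2).lieProj ((fundamentalLatticeRep 2).ρ k))
        ((fundamentalLatticeRep 2).lieProj ((fundamentalLatticeRep 2).ρ k)) = hsForm 2 ((fundamentalLatticeRep 2).lieProj
        ((fundamentalLatticeRep 2).ρ k)) ((fundamentalLatticeRep 2).lieProj ((fundamentalLatticeRep 2).ρ k)) := rfl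
    nlinarith
  change -1 ≤ ((fundamentalLatticeRep 2).ρ k).trace.re / 2 ∧ ((fundamentalLatticeRep 2).ρ k).trace.re / 2 ≤ 1
  constructor <;> nlinarith

/-- `‖k ∓ 1‖² = 4 ∓ 2 Re tr k` on `SU(2)`: hence `Re tr k = 2 ⇒ k = 1` and `Re tr k = −2 ⇒ k = −1`. [folklore] -/
theorem coe_eq_one_of_re_trace_eq_two (k : Matrix.specialUnitaryGroup (Fin 2) ℂ) (hk : (k : Matrix (Fin 2) (Fin 2) ℂ).trace.re = 2) :
    (k : Matrix (Fin 2) (Fin 2) ℂ) = 1 := by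
  have hkk : hsForm 2 (k : Matrix (Fin 2) (Fin 2) ℂ) (k : Matrix (Fin 2) (Fin 2) ℂ) = 2 := hsForm_self_fundamentalRep k
  have hk1 : hsForm 2 (k : Matrix (Fin 2) (Fin 2) ℂ) 1 = 2 := by rw [hsForm_one_right, hk]
  have h1k : hsForm 2 1 (k : Matrix (Fin 2) (Fin 2) ℂ) = 2 := by rw [hsForm_comm, hk1]
  have h11 : hsForm 2 (1 : Matrix (Fin 2) (Fin 2) ℂ) 1 = 2 := by rw [hsForm_one_one]; norm_num
  have h0 : hsForm 2 ((k : Matrix (Fin 2) (Fin 2) ℂ) - 1) ((k : Matrix (Fin 2) (Fin 2) ℂ) - 1) = 0 := by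
    simp only [map_sub, LinearMap.sub_apply, hkk, hk1, h1k, h11]; ring
  exact sub_eq_zero.1 (hsForm_self_eq_zero.1 h0)

/-- `Re tr k = −2 ⇒ k = −1` on `SU(2)`. [folklore] -/
theorem coe_eq_neg_one_of_re_trace_eq_neg_two (k : Matrix.specialUnitaryGroup (Fin 2) ℂ)
    (hk : (k : Matrix (Fin 2) (Fin 2) ℂ).trace.re = -2) : (k : Matrix (Fin 2) (Fin 2) ℂ) = -1 := by
  have hkk : hsForm 2 (k : Matrix (Fin 2) (Fin 2) ℂ) (k : Matrix (Fin 2) (Fin 2) ℂ) = 2 := hsForm_self_fundamentalRep k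
  have hk1 : hsForm 2 (k : Matrix (Fin 2) (Fin 2) ℂ) 1 = -2 := by rw [hsForm_one_right, hk]
  have h1k : hsForm 2 1 (k : Matrix (Fin 2) (Fin 2) ℂ) = -2 := by rw [hsForm_comm, hk1]
  have h11 : hsForm 2 (1 : Matrix (Fin 2) (Fin 2) ℂ) 1 = 2 := by rw [hsForm_one_one]; norm_num
  have h0 : hsForm 2 ((k : Matrix (Fin 2) (Fin 2) ℂ) + 1) ((k : Matrix (Fin 2) (Fin 2) ℂ) + 1) = 0 := by
    simp only [map_add, LinearMap.add_apply, hkk, hk1, h1k, h11]; ring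
  exact eq_neg_of_add_eq_zero_left (hsForm_self_eq_zero.1 h0)

/-- The generator `J = diag(i, −i) ∈ 𝔰𝔲(2)` of the maximal torus: `J ∈ 𝔤`, `|J|² = 2`. [folklore] -/
theorem diag_I_mem_lieAlg_two :
    (!![Complex.I, 0; 0, -Complex.I] : Matrix (Fin 2) (Fin 2) ℂ) ∈ (fundamentalLatticeRep 2).lieAlg ∧
      hsForm 2 (!![Complex.I, 0; 0, -Complex.I] : Matrix (Fin 2) (Fin 2) ℂ) !![Complex.I, 0; 0, -Complex.I] = 2 := by
  have hs : star (!![Complex.I, 0; 0, -Complex.I] : Matrix (Fin 2) (Fin 2) ℂ) = -!![Complex.I, 0; 0, -Complex.I] := by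
    rw [Matrix.star_eq_conjTranspose]
    ext i j
    fin_cases i <;> fin_cases j <;> simp [Matrix.conjTranspose_apply]
  have ht : (!![Complex.I, 0; 0, -Complex.I] : Matrix (Fin 2) (Fin 2) ℂ).trace = 0 := by
    rw [Matrix.trace_fin_two]; simp
  refine ⟨mem_lieAlg_two_of_star_eq_neg hs ht, ?_⟩
  rw [hsForm_self]
  simp [Fin.sum_univ_two]
  norm_num

/-- ★★ **Every logarithm is at least `√2 · arccos(Re tr(h gᴴ)/2)` long**: if `X ∈ 𝔰𝔲(2)` and `e^X g = h` then
`√2 · arccos(Re tr(h gᴴ)/2) ≤ |X|` (`Re tr e^X = 2 cos θ_X` and `arccos (cos θ) ≤ θ` for `θ ≥ 0`). [cite: GallotHulinLafontaine2004, 2.90] -/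
theorem sqrt_two_mul_arccos_le_of_exp_mul_eq (g h : Matrix.specialUnitaryGroup (Fin 2) ℂ) {X : Matrix (Fin 2) (Fin 2) ℂ}
    (hX : X ∈ (fundamentalLatticeRep 2).lieAlg)
    (hexp : NormedSpace.exp X * (g : Matrix (Fin 2) (Fin 2) ℂ) = (h : Matrix (Fin 2) (Fin 2) ℂ)) :
    Real.sqrt 2 * Real.arccos (((h : Matrix (Fin 2) (Fin 2) ℂ) * star (g : Matrix (Fin 2) (Fin 2) ℂ)).trace.re / 2) ≤
      Real.sqrt (hsForm 2 X X) := by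
  set θ : ℝ := Real.sqrt (hsForm 2 X X / 2) with hθdef
  have hθ0 : 0 ≤ θ := Real.sqrt_nonneg _
  have hW : NormedSpace.exp X = (h : Matrix (Fin 2) (Fin 2) ℂ) * star (g : Matrix (Fin 2) (Fin 2) ℂ) := (exp_mul_eq_iff_two g h X).1 hexp
  have htr : (((h : Matrix (Fin 2) (Fin 2) ℂ) * star (g : Matrix (Fin 2) (Fin 2) ℂ)).trace.re) / 2 = Real.cos θ := by
    rw [← hW, re_trace_exp_of_mem_lieAlg_two hX]; ring
  rw [htr]
  have hsq : Real.sqrt (hsForm 2 X X) = Real.sqrt 2 * θ := by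
    rw [hθdef, ← Real.sqrt_mul (by norm_num : (0:ℝ) ≤ 2)]
    congr 1; ring
  rw [hsq]
  refine mul_le_mul_of_nonneg_left ?_ (Real.sqrt_nonneg 2)
  by_cases hπ : θ ≤ Real.pi
  · rw [Real.arccos_cos hθ0 hπ]
  · exact (Real.arccos_le_pi _).trans (le_of_lt (not_le.1 hπ))

/-- ★★ **The minimal logarithm**: for all `g, h ∈ SU(2)` there is `X ∈ 𝔰𝔲(2)` with `e^X g = h` and `|X| = √2 · arccos(Re tr(h gᴴ)/2)`
(`X = (θ/sin θ)·𝐩(h gᴴ)` off the cut locus, `X = π·diag(i, −i)` at `h = −g`).  In particular `exp : 𝔰𝔲(2) → SU(2)` is onto and the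
defining set of `LatticeRep.riemannDist` is never empty on `SU(2)`. [cite: GallotHulinLafontaine2004, 2.108] -/
theorem exists_mem_lieAlg_exp_mul_eq (g h : Matrix.specialUnitaryGroup (Fin 2) ℂ) :
    ∃ X : Matrix (Fin 2) (Fin 2) ℂ, X ∈ (fundamentalLatticeRep 2).lieAlg ∧
      NormedSpace.exp X * (g : Matrix (Fin 2) (Fin 2) ℂ) = (h : Matrix (Fin 2) (Fin 2) ℂ) ∧
      Real.sqrt (hsForm 2 X X) = Real.sqrt 2 * Real.arccos (((h : Matrix (Fin 2) (Fin 2) ℂ) * star (g : Matrix (Fin 2) (Fin 2) ℂ)).trace.re / 2) := by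
  -- the unit quaternion `K = h gᴴ`, its latitude `c` and the angle `θ₀ = arccos c`
  set k : Matrix.specialUnitaryGroup (Fin 2) ℂ := h * g⁻¹ with hkdef
  have hK : (h : Matrix (Fin 2) (Fin 2) ℂ) * star (g : Matrix (Fin 2) (Fin 2) ℂ) = (k : Matrix (Fin 2) (Fin 2) ℂ) := rfl
  rw [hK]
  simp_rw [exp_mul_eq_iff_two g h, hK]
  set c : ℝ := (k : Matrix (Fin 2) (Fin 2) ℂ).trace.re / 2 with hcdef
  obtain ⟨hc1, hc2⟩ := neg_one_le_half_re_trace_two k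
  set θ₀ : ℝ := Real.arccos c with hθ₀
  have hθ₀0 : 0 ≤ θ₀ := Real.arccos_nonneg c
  have hcos : Real.cos θ₀ = c := Real.cos_arccos hc1 hc2
  have hsqrt2θ : ∀ {X : Matrix (Fin 2) (Fin 2) ℂ}, hsForm 2 X X = 2 * θ₀ ^ 2 → Real.sqrt (hsForm 2 X X) = Real.sqrt 2 * θ₀ := by
    intro X hXX
    rw [hXX, Real.sqrt_mul (by norm_num : (0:ℝ) ≤ 2), Real.sqrt_sq hθ₀0]
  by_cases hcm : c = -1
  · -- the cut locus `K = −1`: `X = π · diag(i, −i)`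
    have hKm : (k : Matrix (Fin 2) (Fin 2) ℂ) = -1 := coe_eq_neg_one_of_re_trace_eq_neg_two k (by rw [hcdef] at hcm; linarith)
    have hθπ : θ₀ = Real.pi := by rw [hθ₀, hcm, Real.arccos_neg_one]
    obtain ⟨hJ, hJJ⟩ := diag_I_mem_lieAlg_two
    set X : Matrix (Fin 2) (Fin 2) ℂ := (Real.pi : ℝ) • !![Complex.I, 0; 0, -Complex.I] with hXdef
    have hXmem : X ∈ (fundamentalLatticeRep 2).lieAlg := (fundamentalLatticeRep 2).lieAlg.smul_mem _ hJ
    have hXX : hsForm 2 X X = 2 * Real.pi ^ 2 := by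
      rw [hXdef, hsForm_real_smul_left, hsForm_comm, hsForm_real_smul_left, hJJ]; ring
    refine ⟨X, hXmem, ?_, ?_⟩
    · have hθX : Real.sqrt (hsForm 2 X X / 2) = Real.pi := by
        rw [hXX, show 2 * Real.pi ^ 2 / 2 = Real.pi ^ 2 by ring, Real.sqrt_sq Real.pi_pos.le]
      rw [exp_eq_of_mem_lieAlg_two' hXmem hθX Real.pi_ne_zero, Real.cos_pi, Real.sin_pi, zero_div, hKm]
      simp
    · exact hsqrt2θ (by rw [hXX, hθπ])
  · -- generic case: `X = (θ₀ / sin θ₀) · 𝐩 K`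
    set V : Matrix (Fin 2) (Fin 2) ℂ := (fundamentalLatticeRep 2).lieProj ((fundamentalLatticeRep 2).ρ k) with hVdef
    have hVmem : V ∈ (fundamentalLatticeRep 2).lieAlg := (fundamentalLatticeRep 2).lieProj_mem _
    have hVeq : V = (k : Matrix (Fin 2) (Fin 2) ℂ) - ((c : ℝ) : ℂ) • (1 : Matrix (Fin 2) (Fin 2) ℂ) := lieProj_rho_two k
    have hVV : hsForm 2 V V = 2 * (1 - c ^ 2) := hsForm_lieProj_rho_two k
    have hsin : Real.sin θ₀ ^ 2 = 1 - c ^ 2 := by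
      rw [hθ₀, Real.sin_arccos, Real.sq_sqrt (by nlinarith)]
    have hθπ : θ₀ < Real.pi := by
      rcases (Real.arccos_le_pi c).lt_or_eq with hlt | heq
      · exact hlt
      · exact absurd (Real.arccos_eq_pi.1 heq) (by intro hle; exact hcm (le_antisymm hle hc1))
    set X : Matrix (Fin 2) (Fin 2) ℂ := (θ₀ / Real.sin θ₀) • V with hXdef
    have hXmem : X ∈ (fundamentalLatticeRep 2).lieAlg := (fundamentalLatticeRep 2).lieAlg.smul_mem _ hVmem
    have hXX : hsForm 2 X X = 2 * θ₀ ^ 2 := by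
      rw [hXdef, hsForm_real_smul_left, hsForm_comm, hsForm_real_smul_left, hVV]
      by_cases hs : Real.sin θ₀ = 0
      · -- then `c = 1` (as `c ≠ −1`), `θ₀ = 0`
        have hc1' : c = 1 := by
          have : c ^ 2 = 1 := by nlinarith [hsin, hs]
          have : (c - 1) * (c + 1) = 0 := by ring_nf; nlinarith
          rcases mul_eq_zero.1 this with h1 | h1
          · linarith
          · exact absurd (by linarith : c = -1) hcm
        have : θ₀ = 0 := by rw [hθ₀, hc1', Real.arccos_one]
        rw [hs, this]; ring
      · field_simp
        nlinarith [hsin]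
    refine ⟨X, hXmem, ?_, hsqrt2θ hXX⟩
    by_cases hθ00 : θ₀ = 0
    · -- `θ₀ = 0`: `c = 1`, `K = 1`, `X = 0`
      have hc1' : c = 1 := le_antisymm hc2 (Real.arccos_eq_zero.1 (hθ₀ ▸ hθ00))
      have hK1 : (k : Matrix (Fin 2) (Fin 2) ℂ) = 1 := coe_eq_one_of_re_trace_eq_two k (by rw [hcdef] at hc1'; linarith)
      have hX0 : X = 0 := by rw [hXdef, hθ00, zero_div, zero_smul]
      rw [hX0, NormedSpace.exp_zero, hK1]
    · have hsin0 : Real.sin θ₀ ≠ 0 := (Real.sin_pos_of_pos_of_lt_pi (lt_of_le_of_ne hθ₀0 (Ne.symm hθ00)) hθπ).ne'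
      have hθX : Real.sqrt (hsForm 2 X X / 2) = θ₀ := by
        rw [hXX, show 2 * θ₀ ^ 2 / 2 = θ₀ ^ 2 by ring, Real.sqrt_sq hθ₀0]
      rw [exp_eq_of_mem_lieAlg_two' hXmem hθX hθ00, hcos, hXdef, ← Complex.coe_smul (θ₀ / Real.sin θ₀), smul_smul, ← Complex.ofReal_mul,
        show Real.sin θ₀ / θ₀ * (θ₀ / Real.sin θ₀) = 1 by field_simp, Complex.ofReal_one, one_smul, hVeq]
      abel

/-- ★★★ **Shen–Zhu–Zhu's Riemannian distance on `SU(2)` in closed form**: for the fundamental representation of `SU(2)` (Hilbert–Schmidt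
bi-invariant metric, geodesics `t ↦ e^{tX} g`), `ρ(g, h) = inf{|X| : X ∈ 𝔰𝔲(2), e^X g = h} = √2 · arccos(Re tr(h gᴴ)/2)` — `√2` times the
angle between the unit quaternions `g/√2`, `h/√2` on the sphere `‖·‖_F = √2`; the infimum is a minimum. [cite: GallotHulinLafontaine2004, 2.90 and 2.108] -/
theorem riemannDist_two_eq (g h : Matrix.specialUnitaryGroup (Fin 2) ℂ) :
    (fundamentalLatticeRep 2).riemannDist g h =
      Real.sqrt 2 * Real.arccos (((h : Matrix (Fin 2) (Fin 2) ℂ) * star (g : Matrix (Fin 2) (Fin 2) ℂ)).trace.re / 2) := by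
  rw [LatticeRep.riemannDist]
  refine IsLeast.csInf_eq ⟨?_, ?_⟩
  · obtain ⟨X, hX, hexp, hnorm⟩ := exists_mem_lieAlg_exp_mul_eq g h
    exact ⟨X, ⟨hX, hexp⟩, hnorm⟩
  · rintro _ ⟨X, ⟨hX, hexp⟩, rfl⟩
    exact sqrt_two_mul_arccos_le_of_exp_mul_eq g h hX hexp

/-- The same with `h g⁻¹ ∈ SU(2)` in place of `h gᴴ`. [cite: GallotHulinLafontaine2004, 2.90] -/
theorem riemannDist_two_eq' (g h : Matrix.specialUnitaryGroup (Fin 2) ℂ) :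
    (fundamentalLatticeRep 2).riemannDist g h =
      Real.sqrt 2 * Real.arccos (((h * g⁻¹ : Matrix.specialUnitaryGroup (Fin 2) ℂ) : Matrix (Fin 2) (Fin 2) ℂ).trace.re / 2) :=
  riemannDist_two_eq g h

/-- ★★ **The infimum in `LatticeRep.riemannDist` is attained on `SU(2)`**: some `X ∈ 𝔰𝔲(2)` has `e^X g = h` and `|X| = ρ(g,h)`.
[cite: GallotHulinLafontaine2004, 2.108] -/
theorem exists_mem_lieAlg_exp_mul_eq_sqrt_hsForm_eq_riemannDist (g h : Matrix.specialUnitaryGroup (Fin 2) ℂ) :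
    ∃ X : Matrix (Fin 2) (Fin 2) ℂ, X ∈ (fundamentalLatticeRep 2).lieAlg ∧
      NormedSpace.exp X * (g : Matrix (Fin 2) (Fin 2) ℂ) = (h : Matrix (Fin 2) (Fin 2) ℂ) ∧
      Real.sqrt (hsForm 2 X X) = (fundamentalLatticeRep 2).riemannDist g h := by
  rw [riemannDist_two_eq]
  exact exists_mem_lieAlg_exp_mul_eq g h

end Distance

end Summit.QuantumFields.YangMills.Theorems.ColdStartUniversality

end
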